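/-
Copyright (c) 2026. All rights reserved.
Released under Apache 2.0 license as described in the file LICENSE.
Authors: abc-iut cell, seat abc-iut-f-069 (gen 3; row «P13-INDEX-OFEMBEDDING», abc-iut-L4-lead RULING #8e).
-/
import Literature.AnabelianGeometry.AbsoluteAnabelian.AbsTopII.DPSCDataOfOuterAction
import Literature.AnabelianGeometry.AbsoluteAnabelian.AbsTopII.InertiaGroups
import HarnessLib

/-!
# [AbsTopII] Def 1.2 (ii) / Ex 1.1 (iii): the DPSC data WITH Σ-INDICES of an embedded PSC datum

S. Mochizuki, *Topics in Absolute Anabelian Geometry II* [AbsTopII] (bib `MochizukiAbsTopII2013`; kurims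
manuscript `paper:url-585b8d0ad0d9`), §1: Example 1.1 (iii) p. 9 (the `Σ`-index `i^Σ_e` of a node:
"the largest positive integer `j` such that `i_e/j` is a product of primes `∉ Σ`", where `ξ + η = i_e · σ`
in the stalk `M_e` of the characteristic sheaf), Def 1.2 (ii) p. 10 (the DPSC-extension of PSC
construction data), Prop 1.3 pp. 11–12.

DEFINITION file (abc-iut-L4 DEFS lane), abc-iut-f-069 for abc-iut-L4-lead (RULING #8e «P13-INDEX-OFEMBEDDING»);
ADDITIVE over abc-iut-w5-d226's `DPSCData.ofEmbedding` / `DPSCData.ofOuterAction`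
(`AbsTopII/DPSCDataOfEmbedding.lean` p434909, `AbsTopII/DPSCDataOfOuterAction.lean`) and abc-iut-L4-t6's
`DPSCIndexData` (`AbsTopII/InertiaGroups.lean` p405221) — nothing of either is re-declared:

* `AbsTopII.DPSCIndexData.ofEmbedding G E ι … PiI σ hσ` — the embedded DPSC data of a PSC datum `G`
  (layer L3's `SemiGraphs.PSCDatum`) in a profinite extension `E`, ENRICHED to abc-iut-L4-t6's
  `DPSCIndexData`: `Σ := G.Sigma` (the PSC datum's own set of primes) and the `Σ`-indices `i^Σ_e` of the
  nodes as the ONE extra datum `σ` (a log-structure invariant of Ex 1.1 (iii) that the PSC datum does not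
  carry; constrained only to be `Σ`-integers, as in `DPSCIndexData`);
* `AbsTopII.DPSCIndexData.ofOuterAction G hG θ I σ hσ` — the same at `E := Π_𝒢 ⋊^out_θ J`
  ([AbsTopII] Def 1.2 (ii) "the DPSC-extension associated to the construction data").

PURPOSE: the typed Prop 1.3 (i), (ii), (iii)′, (v)′, (viii)′, (x)′ (`DPSCIndexData.Prop_1_3_*`) can now be
STATED at constructed data, so that the cell's conditional closers (`prop_1_3_iii'_of_branch` etc.)
compose there with the L3 inputs BY NAME (proof-only companion `AbsTopII/DPSCIndexDataOfEmbeddingProofs.lean`).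
HONEST FRAMING: a definition (re-packaging), no claim; typed ≠ proved; nothing here bears on [IUTchIII]
Cor 3.12 or takes a side on any author.
-/

noncomputable section

namespace Literature.AnabelianGeometry.AbsoluteAnabelian

open Literature.AnabelianGeometry.SemiGraphs
open Literature.AnabelianGeometry.Anabelioids (IsSigmaInteger)

universe u

namespace AbsTopII.DPSCIndexData

section Embedding

variable {P : Type u} [Group P] [TopologicalSpace P]
  (G : PSCDatum P) (E : ProfiniteGrp.{u}) (ι : P →* E)
  (hιr : IsClosed (ι.range : Set E)) (hιn : ι.range.Normal)
  (PiI : Subgroup E) (hIn : PiI.Normal) (hle : ι.range ≤ PiI)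
  (σ : G.graph.N → ℕ) (hσ : ∀ e, IsSigmaInteger G.Sigma (σ e))

/-- **[AbsTopII] Def 1.2 (ii) + Ex 1.1 (iii): the DPSC data with `Σ`-indices of a PSC datum embedded in a
profinite extension.**  `Π_H := E`, `Π_𝔾 := ι(Π_𝒢)`, `Π_I := PiI`, vertices / nodes / cusps and `Π_v`, `Π_e`
from `G` (abc-iut-w5-d226's `DPSCData.ofEmbedding`); `Σ := G.Sigma`; `i^Σ_e := σ e` ("the largest positive
integer `j` such that `i_e/j` is a product of primes `∉ Σ`" — a datum of the log structure at the node `e`,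
here an arbitrary `Σ`-integer-valued function). [cite: MochizukiAbsTopII2013, Def 1.2 (ii) p.10] -/
def ofEmbedding : DPSCIndexData.{u} where
  toDPSCData := DPSCData.ofEmbedding G E ι hιr hιn PiI hIn hle
  Sigma := G.Sigma
  sigma_prime := ⟨G.sigma_nonempty, G.sigma_prime⟩
  sigmaIndex e := σ e.down
  sigmaIndex_isSigmaInteger e := hσ e.down

/-- The underlying DPSC data is `DPSCData.ofEmbedding`. [cite: MochizukiAbsTopII2013, Def 1.2 (ii) p.10] -/
theorem ofEmbedding_toDPSCData :
    (ofEmbedding G E ι hιr hιn PiI hIn hle σ hσ).toDPSCData = DPSCData.ofEmbedding G E ι hιr hιn PiI hIn hle :=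
  rfl

/-- `Σ` of the embedded datum is the PSC datum's `Σ`. [cite: MochizukiAbsTopII2013, Ex 1.1 (i) p.8] -/
theorem ofEmbedding_Sigma : (ofEmbedding G E ι hιr hιn PiI hIn hle σ hσ).Sigma = G.Sigma := rfl

/-- The `Σ`-index of a node of the embedded datum. [cite: MochizukiAbsTopII2013, Ex 1.1 (iii) p.9] -/
theorem ofEmbedding_sigmaIndex (e : (ofEmbedding G E ι hιr hιn PiI hIn hle σ hσ).Node) :
    (ofEmbedding G E ι hιr hιn PiI hIn hle σ hσ).sigmaIndex e = σ e.down := rfl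

end Embedding

section OuterAction

variable {P : Type u} [Group P] [TopologicalSpace P] [IsTopologicalGroup P] [CompactSpace P]
  [TotallyDisconnectedSpace P] (G : PSCDatum P) (hG : IsTopologicallyFinitelyGenerated P)
  {J : Type u} [Group J] [TopologicalSpace J] [IsTopologicalGroup J] [CompactSpace J]
  [TotallyDisconnectedSpace J] (θ : J →ₜ* outProfinite hG) (I : Subgroup J) [I.Normal]
  (σ : G.graph.N → ℕ) (hσ : ∀ e, IsSigmaInteger G.Sigma (σ e))

/-- **[AbsTopII] Def 1.2 (ii): the DPSC data with `Σ`-indices of the construction data** (`Π_H := Π_𝒢 ⋊^out_θ J`,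
`Π_I := Π_H ×_J I`; abc-iut-w5-d226's `DPSCData.ofOuterAction`), `Σ := G.Sigma`, `i^Σ_e := σ e`.
[cite: MochizukiAbsTopII2013, Def 1.2 (ii) p.10] -/
def ofOuterAction : DPSCIndexData.{u} :=
  ofEmbedding G (outerSemidirectProfinite hG θ) (inlProfinite hG θ).toMonoidHom
    (isClosed_range_inlProfinite hG θ) (range_inlProfinite_normal hG θ)
    (I.comap (sndProfinite hG θ).toMonoidHom) inferInstance (DPSCData.range_inl_le_comap_snd hG θ I) σ hσ

/-- The underlying DPSC data is `DPSCData.ofOuterAction`. [cite: MochizukiAbsTopII2013, Def 1.2 (ii) p.10] -/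
theorem ofOuterAction_toDPSCData :
    (ofOuterAction G hG θ I σ hσ).toDPSCData = DPSCData.ofOuterAction G hG θ I := rfl

/-- `Σ` of the constructed datum is the PSC datum's `Σ`. [cite: MochizukiAbsTopII2013, Ex 1.1 (i) p.8] -/
theorem ofOuterAction_Sigma : (ofOuterAction G hG θ I σ hσ).Sigma = G.Sigma := rfl

end OuterAction

end AbsTopII.DPSCIndexData

end Literature.AnabelianGeometry.AbsoluteAnabelian

end
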